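import Literature.Computability.AlgebraicComplexity.DeterminantalComplexityAlgClosedDescent
import Mathlib.FieldTheory.IsAlgClosed.AlgebraicClosure
import Mathlib.Analysis.Complex.Polynomial.Basic

/-!
# Route PrincipalMinorColouring — piece B `ConstantEliminationQP`, line `ConstantEliminationQP_birth`,
# stub `stub_algebraicRepr` (a complex determinantal representation of `per_n` descends to `ℚ̄`)

Crux item `stmt-ValiantsHypothesis-18048` (`PrincipalMinorColouring.ConstantEliminationQP`, piece B of the
constants-seam split of `TotalRankNotQP`), line `Cruxes/TotalRankNotQP/Lines/ConstantEliminationQP_birth.lean`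
(stubs `stub_algebraicRepr` [provable now], `stub_lowDegreePoint` [THE BET], `stub_restrictionOfScalars`).
This file proves `stub_algebraicRepr` VERBATIM:

  `∀ n m, HasDetRepr (perPoly (Fin n) ℂ) m → HasDetRepr (perPoly (Fin n) (AlgebraicClosure ℚ)) m`,

as the instance `k = ℚ̄ ⊆ K = ℂ` (along an embedding `ℚ̄ →ₐ[ℚ] ℂ`, `IsAlgClosed.lift`) of the tree's
Nullstellensatz descent of affine determinantal representations
(`Literature.Computability.AlgebraicComplexity.hasDetRepr_perPoly_iff_of_isAlgClosed`,
`DeterminantalComplexityAlgClosedDescent.lean`: the size-`m` representation variety of `per_n` is defined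
over `ℚ̄`, a `ℂ`-point gives a `ℚ̄`-point).

Honest framing: bookkeeping (Lefschetz principle); `ConstantEliminationQP` (a named open problem:
elimination of constants at quasi-polynomial cost) and the bet `stub_lowDegreePoint` remain OPEN;
nothing here bears on `VP ≠ VNP`.
-/

-- Sub = Summit layout duplicates the namespace component
set_option linter.dupNamespace false

noncomputable section

namespace Summit.ValiantsHypothesis.ValiantsHypothesis.Theorems.PrincipalMinorColouring.ConstantEliminationQP

open Literature.Computability.AlgebraicComplexity

/-- **Stub `stub_algebraicRepr`** (line `ConstantEliminationQP_birth`, registered signature verbatim): a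
complex affine determinantal representation of `per_n` of size `m` yields one over `ℚ̄ = AlgebraicClosure ℚ`
of the same size — Nullstellensatz descent along an embedding `ℚ̄ → ℂ`
(`hasDetRepr_perPoly_iff_of_isAlgClosed`). -/
theorem stub_algebraicRepr :
    ∀ n m : ℕ, HasDetRepr (perPoly (Fin n) ℂ) m →
      HasDetRepr (perPoly (Fin n) (AlgebraicClosure ℚ)) m := by
  intro n m h
  haveI : Algebra.IsAlgebraic ℚ (AlgebraicClosure ℚ) := AlgebraicClosure.isAlgebraic ℚ
  letI : Algebra (AlgebraicClosure ℚ) ℂ :=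
    (IsAlgClosed.lift (R := ℚ) (S := AlgebraicClosure ℚ) (M := ℂ)).toRingHom.toAlgebra
  exact (hasDetRepr_perPoly_iff_of_isAlgClosed (AlgebraicClosure ℚ) ℂ (Fin n) m).1 h

/-- The converse direction (ascent, for the record): a `ℚ̄`-representation gives a complex one of the
same size (`HasDetRepr.map_holds` along the embedding; `map_perPoly`). -/
theorem hasDetRepr_perPoly_complex_of_algebraicClosure (n m : ℕ)
    (h : HasDetRepr (perPoly (Fin n) (AlgebraicClosure ℚ)) m) : HasDetRepr (perPoly (Fin n) ℂ) m := by
  haveI : Algebra.IsAlgebraic ℚ (AlgebraicClosure ℚ) := AlgebraicClosure.isAlgebraic ℚ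
  letI : Algebra (AlgebraicClosure ℚ) ℂ :=
    (IsAlgClosed.lift (R := ℚ) (S := AlgebraicClosure ℚ) (M := ℂ)).toRingHom.toAlgebra
  exact (hasDetRepr_perPoly_iff_of_isAlgClosed (AlgebraicClosure ℚ) ℂ (Fin n) m).2 h

/-- Hence `dc_ℂ(per_n) = dc_{ℚ̄}(per_n)` (`determinantalComplexity_perPoly_of_isAlgClosed`). -/
theorem determinantalComplexity_perPoly_complex_eq_algebraicClosure (n : ℕ) :
    determinantalComplexity (perPoly (Fin n) ℂ) =
      determinantalComplexity (perPoly (Fin n) (AlgebraicClosure ℚ)) := by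
  haveI : Algebra.IsAlgebraic ℚ (AlgebraicClosure ℚ) := AlgebraicClosure.isAlgebraic ℚ
  letI : Algebra (AlgebraicClosure ℚ) ℂ :=
    (IsAlgClosed.lift (R := ℚ) (S := AlgebraicClosure ℚ) (M := ℂ)).toRingHom.toAlgebra
  exact determinantalComplexity_perPoly_of_isAlgClosed (AlgebraicClosure ℚ) ℂ (Fin n)

end Summit.ValiantsHypothesis.ValiantsHypothesis.Theorems.PrincipalMinorColouring.ConstantEliminationQP

end
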